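import Summits.BirchSwinnertonDyer.BirchSwinnertonDyer.Theorems.ByReductionTypeAtTwoOrdKatoOptimalDefs
import Summits.BirchSwinnertonDyer.BirchSwinnertonDyer.Theorems.ByReductionTypeAtTwoOrdKatoHalfIsogeny
import HarnessLib

/-!
# Route ByReductionTypeAtTwo, crux `OrdKatoHalfAtTwoIso` (stmt-BirchSwinnertonDyer-19573): the LEDGER
# IDENTITY after MEMO-7 — the crux BY NAME from three displayed binders + print — and the per-member
# doors on the `E[2]`-reducible / `C₃` locus (MEMO-7 Cor. D2 / D3)

Seat `bsd-2adic-ord` GEN 10 (HOME `run/shared/lean/pub/bsd-2adic/`, MEMO-7 FROZEN @03fe385917e0b426).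
Companion of the Theses-free binder file `ByReductionTypeAtTwoOrdKatoOptimalDefs.lean`; this file imports the
route file (through `…OrdKatoHalfIsogeny`) only to conclude the two route declarations BY NAME. Nothing
asserted: every statement is conditional on the displayed binders.

* `ordKatoHalfAtTwoIso_of_binders` — **`OrdKatoHalfAtTwoIso` (19573) BY NAME** from
  {`KatoMuPartAtOptimalMemberOfNotSurjectiveTwo` (CELL-MEMO, MEMO-7), `KatoIntAtGoodOrdSurjectiveTwo`
  (RESERVE/MEMO, GEN 8), `OrdKatoHalfDD12ResidueTwo` (OPEN residue), `h17` (PRINT)} — MEMO-7 Cor. D3 as a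
  kernel-checked identity: after GEN 10 the crux is open EXACTLY on the DD12 residue.
* `ordKatoHalfAtTwo_of_binders` — **`OrdKatoHalfAtTwo` (19271) BY NAME** from the same + the route's PUB
  package `OrdPublishedInputsAtTwo` + Cassels (`bsdRHS_eq_of_isIsogenous`), via ord-2's
  `KatoHalfIsogeny.ordKatoHalfAtTwo_of_ordKatoHalfAtTwoIso`.
* `mainConjectureLowerDivisibilityAtTwoOrd_of_binder_of_pub` — **MEMO-7 Cor. D2**: on the non-surjective
  locus (`E[2]` reducible or `C₃`) at analytic rank `0`, the typed item AT EVERY MEMBER `W` from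
  {binder, PUB, Cassels} (Kato-optimal member + MEMO-4's isogeny transport) — the Kato direction of
  Greenberg's `μ_E = m_E` at `2` on the whole reducible locus.
* `bsdp_two_of_binder_of_pub_of_missingLowerBoundAt` — the per-class door: + ONE descent certificate
  `MissingLowerBoundAt W 2` ⇒ `BSDp W 2` (no `λ`/`μ` certificate, no tower, no Prop-5.14 point).

HONEST FRAMING (cell `bsd-2adic`): the binders are memo-grade statements DISPLAYED by name; rows through
these doors are NO-OFFER until a binder is print or kernel. PARTITION: X5@2 good-ord (B1·O1; 611 classes;
the 169 `E[2]`-reducible + 2 `C₃` classes for the doors, all 611 for the identity) × p = 2 —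
types-the-object-of; closes none; nothing booked; BSD is not proved by any of this.
-/

set_option autoImplicit false
set_option linter.dupNamespace false

noncomputable section

open scoped Classical MatrixGroups ModularForm

open CongruenceSubgroup WeierstrassCurve Literature.NumberTheory.EllipticCurves
  Literature.NumberTheory.EllipticCurves.ModularForms
  Literature.NumberTheory.EllipticCurves.Rank1Residual
  Literature.NumberTheory.EllipticCurves.Rank1Residual.Typed
  Summit.BirchSwinnertonDyer.Rank1Residual.X5
  Summit.BirchSwinnertonDyer.BirchSwinnertonDyer.Theses.ByReductionTypeAtTwo
  Summit.BirchSwinnertonDyer.BirchSwinnertonDyer.Theorems.OrdKatoIntAtTwo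
  Summit.BirchSwinnertonDyer.BirchSwinnertonDyer.Theorems.KatoHalfIsogeny

namespace Summit.BirchSwinnertonDyer.BirchSwinnertonDyer.Theorems.OrdKatoOptimalAtTwo

/-- **MEMO-7 Cor. D3 as a kernel identity: the crux `OrdKatoHalfAtTwoIso` (stmt-BirchSwinnertonDyer-19573)
BY NAME from the three displayed binders and Kato 17.4 (1)(2) at `2`.** Image trichotomy at a non-CM
good-ordinary curve: `ρ̄₂` not onto ⇒ MEMO-7 binder (Kato-optimal member); `ρ̄₂` onto and `ρ_{2^∞}` onto ⇒
GEN 8 binder (W_K2 / MEMO-5/6) at `W` itself; `ρ̄₂` onto, `ρ_{2^∞}` not onto ⇒ the OPEN residue binder.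
Conditional on three `@[conjecture]` constants — nothing is closed by this theorem.
[cite: Kato2004Asterisque, Thm. 17.4 (1)(2) (p. 273)] -/
theorem ordKatoHalfAtTwoIso_of_binders (hB7 : KatoMuPartAtOptimalMemberOfNotSurjectiveTwo)
    (hB8 : KatoIntAtGoodOrdSurjectiveTwo) (hDD : OrdKatoHalfDD12ResidueTwo)
    (h17 : ∀ (V : WeierstrassCurve ℚ) [V.IsElliptic] [V.IsGloballyMinimal] [NeZero (V.conductorNorm ℤ)]
      (f : CuspForm (Gamma0 (V.conductorNorm ℤ)) 2), kato_divisibility_allPrimes V 2 (f := f)) :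
    OrdKatoHalfAtTwoIso :=
  fun W _ _ hcm _ hgo =>
    exists_isIsogenous_mainConjectureLowerDivisibilityAtTwoOrd_of_binders W hB7 hB8 hDD h17 hcm hgo

/-- **The `∀`-member aside `OrdKatoHalfAtTwo` (stmt-BirchSwinnertonDyer-19271) BY NAME** from the three
binders, the route's PUB package (modularity, GZK, Kato 17.4 (1)(2) at `2`, Greenberg Thm. 4.1) and Cassels'
isogeny invariance, through ord-2's transport `ordKatoHalfAtTwo_of_ordKatoHalfAtTwoIso`.
[cite: GreenbergLNM1716, Thm. 4.1 (p. 102) and p. 170] [cite: Kato2004Asterisque, Thm. 17.4 (1)(2) (p. 273)] -/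
theorem ordKatoHalfAtTwo_of_binders (hPub : OrdPublishedInputsAtTwo) (hCassels : bsdRHS_eq_of_isIsogenous)
    (hB7 : KatoMuPartAtOptimalMemberOfNotSurjectiveTwo) (hB8 : KatoIntAtGoodOrdSurjectiveTwo)
    (hDD : OrdKatoHalfDD12ResidueTwo) : OrdKatoHalfAtTwo := by
  have hPub' := hPub
  obtain ⟨_, _, h17, _⟩ := hPub'
  exact ordKatoHalfAtTwo_of_ordKatoHalfAtTwoIso hPub hCassels (ordKatoHalfAtTwoIso_of_binders hB7 hB8 hDD h17)

variable (W : WeierstrassCurve ℚ) [W.IsElliptic] [W.IsGloballyMinimal]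

/-- **MEMO-7 Cor. D2 — the typed item AT EVERY MEMBER of an analytic-rank-`0`, non-CM, good-ordinary class
with `ρ̄₂` not onto** (`E[2]` reducible or image `C₃`): binder (item at the Kato-optimal member `W′`) +
the route's PUB package + Cassels, via ord-2's isogeny transport
`KatoHalfIsogeny.mainConjectureLowerDivisibilityAtTwoOrd_of_isIsogenous` from `W′` back to `W`. In
Greenberg's language: `μ(X(E/ℚ_∞)) ≤ μ(ϖ_E·L₂(f,α))` for every member (the Kato direction of «μ_E = m_E»).
[cite: GreenbergLNM1716, p. 170 (conjecturally μ_E = m_E) and Thm. 4.1 (p. 102)]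
[cite: Kato2004Asterisque, Thm. 17.4 (1)(2) (p. 273)] -/
theorem mainConjectureLowerDivisibilityAtTwoOrd_of_binder_of_pub
    (hB7 : KatoMuPartAtOptimalMemberOfNotSurjectiveTwo) (hPub : OrdPublishedInputsAtTwo)
    (hCassels : bsdRHS_eq_of_isIsogenous) (hcm : ¬ W.HasCM) (hr : W.analyticRank = 0)
    (hgo : GoodOrd W 2) (him : ¬ W.HasSurjectiveModNGaloisRep 2) :
    O1.MainConjectureLowerDivisibilityAtTwoOrd W := by
  obtain ⟨hmod, hGZK, h17, hGr⟩ := hPub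
  obtain ⟨W', _, _, hiso, hK'⟩ :=
    exists_isIsogenous_mainConjectureLowerDivisibilityAtTwoOrd_of_binder W hB7 h17 hcm hgo him
  have hgo' : GoodOrd W' 2 := goodOrd_two_of_isIsogenous W hiso hgo
  have hr' : W'.analyticRank = 0 := by rw [← analyticRank_eq_of_isIsogenous' hiso, hr]
  exact mainConjectureLowerDivisibilityAtTwoOrd_of_isIsogenous hGZK hmod hCassels (fun f => h17 W' f)
    (O1.twoAdicEulerCharRankZero_zero_of_greenberg W' hGr)
    (O1.twoAdicEulerCharRankZero_zero_of_greenberg W hGr) hiso.symm_of_charZero hgo' hgo hr' hK'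

/-- **The per-class door on the non-surjective locus (MEMO-7 §4.4)**: binder + PUB package + Cassels + ONE
descent certificate `hlow : MissingLowerBoundAt W 2` (`ord₂ #Ш_an ≤ ord₂ #Ш`) ⇒ `BSD(E,2)` on a rank-`0`
good-ordinary non-CM curve with `ρ̄_{E,2}` not onto — through
`O1.missingUpperBoundAt_two_of_mainConjectureLowerDivisibilityAtTwoOrd_of_kato`. No `λ`/`μ` certificate, no
tower, no Prop-5.14 point; NO-OFFER at the binder's tier. [cite: Miller2011LMS, Def. 1.1 and §1]
[cite: GreenbergLNM1716, Thm. 4.1 (p. 102)] [cite: Kato2004Asterisque, Thm. 17.4 (1)(2) (p. 273)] -/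
theorem bsdp_two_of_binder_of_pub_of_missingLowerBoundAt
    (hB7 : KatoMuPartAtOptimalMemberOfNotSurjectiveTwo) (hPub : OrdPublishedInputsAtTwo)
    (hCassels : bsdRHS_eq_of_isIsogenous) (hcm : ¬ W.HasCM) (hr : W.analyticRank = 0)
    (hgo : GoodOrd W 2) (him : ¬ W.HasSurjectiveModNGaloisRep 2) (hlow : MissingLowerBoundAt W 2) :
    BSDp W 2 := by
  have hK := mainConjectureLowerDivisibilityAtTwoOrd_of_binder_of_pub W hB7 hPub hCassels hcm hr hgo him
  obtain ⟨hmod, hGZK, h17, hGr⟩ := hPub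
  exact bsdp_of_missingPPartAt W 2 hGZK (by rw [hr]; exact zero_le_one)
    (missingPPartAt_of_lower_of_upper W 2 hlow
      (O1.missingUpperBoundAt_two_of_mainConjectureLowerDivisibilityAtTwoOrd_of_kato W
        (O1.twoAdicEulerCharRankZero_zero_of_greenberg W hGr) hmod hGZK (fun f => h17 W f) hr hgo hK))

end Summit.BirchSwinnertonDyer.BirchSwinnertonDyer.Theorems.OrdKatoOptimalAtTwo

end
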